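import Literature.NumberTheory.ComplexMultiplication.ReflexDegreeImprimitivity
import Literature.AlgebraicGeometry.Pohlmann1968.NondegenerateCMTypeHodgeConjecture
import HarnessLib

/-!
# The case `v = n`: `[Kᶜ : K₀ᶜ] = 2ⁿ` — a single orbit of CM types, every reflex degree maximal (`2ⁿ`), every
# CM type nondegenerate (Dodson 1984 §1.2, §5.1.3; Ribet 1980 Cor. 3.6)

Sequel of `ReflexDegreeImprimitivity.lean` (Dodson's imprimitivity sequence `1 → (ℤ₂)ᵛ → Gal(Kᶜ/ℚ) → G₀ → 1`
and the Reflex Degree Theorem `[K′ : ℚ] = 2ᵛ (G₀ : S₀)`, `2ᵛ = [Kᶜ : K₀ᶜ]`).  Here the extreme case `v = n`,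
`2n = [K : ℚ]` — the kernel `Gal(Kᶜ/K₀ᶜ)` is ALL of `(ℤ₂)ⁿ` (every sign change of the `n` pairs of conjugate
embeddings is a Galois automorphism; e.g. the "generic" CM field with `Gal(Kᶜ/ℚ) = (ℤ₂)ⁿ ⋊ 𝔖ₙ`):

* B. Dodson, *The structure of Galois groups of CM-fields*, Trans. AMS **283** (1984) [Dodson1984] (held
  `paper:doi-10-2307-1999987`), §1.2 Proposition (p. 4): "`K` has `2ⁿ` CM-types `(K, Φ)`, where each type `Φ` on
  `K` may be viewed as giving `n` choices, picking one embedding from each of the sets `{τⱼ, τ̄ⱼ}`";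
  **§5.1.3 Proposition 1** (p. 20): "… `2³ = 8` holds for both `G = (ℤ₂)³ ⋊ G₀` … The case `G = (ℤ₂)⁵ ⋊ G₀`
  gives a single orbit, `2⁵ = 32`", proof: "**That the case `v = n` gives a single orbit has been previously
  distinguished by Shimura [18, §1]**" ([18] = Shimura, Ann. of Math. 91 (1970), §1); p. 1: "Shimura has shown
  that there exist CM-fields such that the maximal degree `[K′ : ℚ] = 2ⁿ` occurs".
* K. A. Ribet, *Division fields of abelian varieties with complex multiplication*, Mém. SMF 2 (1980) [Ribet1980],
  §3 **Cor. (3.6)** (p. 87): "Suppose that we have `d′ = 2^{d−1}`.  Then `(E, S)` is non-degenerate" — so when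
  `v = n` EVERY CM type of `K` is nondegenerate (Kubota rank `n + 1`), whence (Pohlmann / White / Hazama, the
  tree's `Pohlmann1968/NondegenerateCMType*`) the Hodge ring of every power of every abelian variety with CM by
  `K` is generated by divisor classes and the Hodge conjecture holds there.

## Contents (everything PROVED; theorems only — no definition, no named fact, net debt 0)

Part I, GROUP LEVEL (`G` acting on `E`, `ρ`, `IsCMTypeWith ρ Φ`, pair kernel `V` characterised by
`hV : g ∈ V ↔ ∀ x, g • x = x ∨ g • x = ρ • x` as in the predecessor file):
* `IsCMTypeWith.natCard_setOf_isCMTypeWith` — §1.2: there are exactly `2ⁿ` CM types for `ρ` (`n = |E|/2`);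
* `IsCMTypeWith.card_orbit_eq_two_pow_of_card_pairKernel_eq` — `|V| = 2ⁿ ⟹ |G · Φ| = 2ⁿ`;
  `….orbit_eq_setOf_isCMTypeWith_of_card_pairKernel_eq` / `….mem_orbit_of_card_pairKernel_eq` — **a single
  orbit**: every CM type is a Galois translate of `Φ`; `….isComplement'_stabilizer_of_card_pairKernel_eq` —
  `H′(Φ)` is a complement of `(ℤ₂)ⁿ`;
* `IsCMTypeWith.typeRank_eq_of_card_orbit_eq_two_pow` — **Ribet's Cor. (3.6) at group level**: an orbit of size
  `2ⁿ` forces `rank(Φ) = n + 1`; `….typeRank_eq_of_card_pairKernel_eq` — `v = n ⟹` every CM type nondegenerate;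
* `IsCMTypeWith.card_pairKernel_eq_two_pow_of_flips` — if `G` contains a flip of every pair (the hypothesis of
  `CMTypeRankPairFlipTransfer.exists_pairPreserving_translate`) then `|V| = 2ⁿ`.

Part II, NUMBER FIELDS (`K` CM, `L` a normal closure of `K` — CM by `isCMField_of_isNormalClosure` —,
`K₀ᶜ = normalClosure ℚ K⁺ L`, hypothesis `[L : K₀ᶜ] = 2ⁿ`, `2n = [K : ℚ]`):
* `finrank_reflexField_eq_two_pow_of_finrank_normalClosure_eq` — every CM type has `[K′ : ℚ] = 2ⁿ`;
  `exists_smul_eq_of_finrank_normalClosure_eq` — all CM types of `K` are `Gal(L/ℚ)`-conjugate (Dodson §5.1.3 /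
  Shimura); `isComplement'_of_finrank_normalClosure_eq`, `reflexField_inf_normalClosure_eq_bot_of_finrank_eq`
  (`K′ ∩ K₀ᶜ = ℚ`, `Gal(L/K′)` splits the imprimitivity sequence);
* **`isNondegenerate_of_finrank_normalClosure_eq`** — every complex CM type `Φ : CMType K` is nondegenerate
  (Ribet Cor. 3.6 through the tree's `isNondegenerate_of_finrank_reflexField_eq`); and on abelian varieties, for
  every realisation `(A, ι, θ)` of any `(K; Φ)`: **`hodgeClassSpan_pow_eq_divisorClassesSpan_of_finrank_normalClosure_eq`**
  (`Bᵐ(Aᵏ) ⊗ ℂ = Dᵐ(Aᵏ) ⊗ ℂ`: no exceptional Hodge classes on any power) and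
  **`hodgeConjectureFor_pow_of_finrank_normalClosure_eq`** (the Hodge conjecture for every power), UNCONDITIONAL.

## References

* [Dodson1984] B. Dodson, Trans. AMS 283 (1984), §1.2 Proposition, §1.3, §2.1.2 Corollary, §5.1.3 Proposition 1.
* [Ribet1980] K. A. Ribet, Mém. SMF (2) 2 (1980), §3 (3.1), Cor. (3.6).
* [Gordon1999HodgeAVSurvey] B. B. Gordon, *A survey of the Hodge conjecture for abelian varieties*, Thm. 6.4, §9.3
  (nondegenerate ⟹ `Hdg = Div` on all powers; through the tree's `Pohlmann1968/NondegenerateCMTypeHodgeConjecture`).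
-/

set_option autoImplicit false

open scoped Pointwise

namespace Literature.NumberTheory.ComplexMultiplication

/-! ## Part I — group level -/

section GroupLevel

variable {G : Type*} [Group G] {E : Type*} [MulAction G E] {ρ : G} {Φ : Set E}

namespace IsCMTypeWith

/-- **"`K` has `2ⁿ` CM-types"** (`n = |E|/2` pairs; a CM type picks one embedding from each pair `{x, ρx}`): the
CM types for `ρ` are in bijection with the subsets of a fixed one, `Ψ ↦ Ψ ∩ Φ`.
[cite: Dodson1984, §1.2 Proposition] -/
theorem natCard_setOf_isCMTypeWith [Finite E] (h : IsCMTypeWith ρ Φ) :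
    Nat.card {Ψ : Set E // IsCMTypeWith ρ Ψ} = 2 ^ (Nat.card E / 2) := by
  classical
  haveI : Fintype E := Fintype.ofFinite E
  have hhalf : Nat.card Φ = Nat.card E / 2 := by
    rw [Nat.card_coe_set_eq]
    have := two_mul_ncard_eq_card_of_cm (c := ρ) h.mem_iff
    omega
  have hfun : Nat.card (Φ → Bool) = 2 ^ (Nat.card E / 2) := by
    rw [Nat.card_fun, ← hhalf, Nat.card_eq_fintype_card (α := Bool), Fintype.card_bool]
  apply le_antisymm
  · -- `Ψ ↦ (x ↦ [x ∈ Ψ])` on `Φ` is injective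
    have hinj : Function.Injective fun (Ψ : {Ψ : Set E // IsCMTypeWith ρ Ψ}) (x : Φ) =>
        decide ((x : E) ∈ (Ψ : Set E)) := by
      rintro ⟨Ψ₁, h₁⟩ ⟨Ψ₂, h₂⟩ h12
      have h12' : ∀ x : E, x ∈ Φ → (x ∈ Ψ₁ ↔ x ∈ Ψ₂) := fun x hx => by
        have := congrFun h12 ⟨x, hx⟩
        simpa only [decide_eq_decide] using this
      apply Subtype.ext
      ext x
      by_cases hx : x ∈ Φ
      · exact h12' x hx
      · have hρx : ρ • x ∈ Φ := (h.rho_smul_mem_iff x).2 hx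
        rw [h₁.mem_iff x, h₂.mem_iff x, h12' (ρ • x) hρx]
    rw [← hfun]
    exact Nat.card_le_card_of_injective _ hinj
  · -- `f ↦ {x ∈ Φ | f x} ∪ {x ∉ Φ | ¬ f (ρx)}` is injective
    let toType : (Φ → Bool) → Set E := fun f =>
      {x | (∃ hx : x ∈ Φ, f ⟨x, hx⟩ = true) ∨ (∃ hx : ρ • x ∈ Φ, f ⟨ρ • x, hx⟩ = false)}
    have hmemΦ : ∀ (f : Φ → Bool) (x : E) (hx : x ∈ Φ), x ∈ toType f ↔ f ⟨x, hx⟩ = true := by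
      intro f x hx
      have hρx : ρ • x ∉ Φ := (h.mem_iff x).1 hx
      simp only [toType, Set.mem_setOf_eq]
      constructor
      · rintro (⟨hx', hf⟩ | ⟨hρ, -⟩)
        · exact hf
        · exact absurd hρ hρx
      · intro hf
        exact Or.inl ⟨hx, hf⟩
    have hmemΦc : ∀ (f : Φ → Bool) (x : E) (hx : ρ • x ∈ Φ), x ∈ toType f ↔ f ⟨ρ • x, hx⟩ = false := by
      intro f x hx
      have hxΦ : x ∉ Φ := fun hxΦ => (h.mem_iff x).1 hxΦ hx
      simp only [toType, Set.mem_setOf_eq]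
      constructor
      · rintro (⟨hx', -⟩ | ⟨hρ, hf⟩)
        · exact absurd hx' hxΦ
        · exact hf
      · intro hf
        exact Or.inr ⟨hx, hf⟩
    have hcm : ∀ f : Φ → Bool, IsCMTypeWith ρ (toType f) := by
      intro f
      refine ⟨fun x => ?_, h.comm, h.invol⟩
      by_cases hx : x ∈ Φ
      · have hρρx : ρ • ρ • x ∈ Φ := by rw [h.invol]; exact hx
        rw [hmemΦ f x hx, hmemΦc f (ρ • x) hρρx]
        have he : (⟨ρ • ρ • x, hρρx⟩ : Φ) = ⟨x, hx⟩ := Subtype.ext (h.invol x)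
        rw [he]
        simp
      · have hρx : ρ • x ∈ Φ := (h.rho_smul_mem_iff x).2 hx
        rw [hmemΦc f x hρx, hmemΦ f (ρ • x) hρx]
        simp
    have hinj : Function.Injective fun f : Φ → Bool =>
        (⟨toType f, hcm f⟩ : {Ψ : Set E // IsCMTypeWith ρ Ψ}) := by
      intro f₁ f₂ h12
      have h12' : toType f₁ = toType f₂ := congrArg Subtype.val h12
      funext x
      have e1 := hmemΦ f₁ x x.2
      have e2 := hmemΦ f₂ x x.2
      rw [h12'] at e1
      rcases Bool.eq_false_or_eq_true (f₁ x) with hf | hf <;>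
        rcases Bool.eq_false_or_eq_true (f₂ x) with hg | hg
      · rw [hf, hg]
      · exact absurd (e2.1 (e1.2 hf)) (by rw [hg]; decide)
      · exact absurd (e1.1 (e2.2 hg)) (by rw [hf]; decide)
      · rw [hf, hg]
    rw [← hfun]
    exact Nat.card_le_card_of_injective _ hinj

/-- Every translate of a CM type is a CM type (the orbit lies inside the `2ⁿ` types). [cite: Ribet1980, §3 (3.1) (p. 85)] -/
theorem orbit_subset_setOf_isCMTypeWith (h : IsCMTypeWith ρ Φ) :
    MulAction.orbit G Φ ⊆ {Ψ : Set E | IsCMTypeWith ρ Ψ} := by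
  rintro Ψ ⟨g, rfl⟩
  refine ⟨fun x => ?_, h.comm, h.invol⟩
  change x ∈ g • Φ ↔ ρ • x ∉ g • Φ
  rw [Set.mem_smul_set_iff_inv_smul_mem, Set.mem_smul_set_iff_inv_smul_mem, h.comm, h.mem_iff]

/-- **`v = n` ⟹ `[K′ : ℚ] = 2ⁿ`**, group level: if the pair kernel has all `2ⁿ` elements then the orbit of every CM
type has `2ⁿ` elements (`|V|` divides `|G · Φ| ≤ 2ⁿ`). [cite: Dodson1984, §1.3 Reflex Degree Theorem] -/
theorem card_orbit_eq_two_pow_of_card_pairKernel_eq [FaithfulSMul G E] [Finite G] [Finite E]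
    (h : IsCMTypeWith ρ Φ) {V : Subgroup G} (hV : ∀ g : G, g ∈ V ↔ ∀ x : E, g • x = x ∨ g • x = ρ • x)
    (hv : Nat.card V = 2 ^ (Nat.card E / 2)) :
    Nat.card (MulAction.orbit G Φ) = 2 ^ (Nat.card E / 2) := by
  classical
  haveI : Fintype E := Fintype.ofFinite E
  have hdvd := h.card_pairKernel_dvd_card_orbit hV
  have hle := h.card_orbit_le_two_pow
  rw [← Nat.card_eq_fintype_card] at hle
  rw [hv] at hdvd
  haveI : Nonempty (MulAction.orbit G Φ) := ⟨⟨Φ, MulAction.mem_orbit_self Φ⟩⟩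
  have hpos : 0 < Nat.card (MulAction.orbit G Φ) := Nat.card_pos
  exact le_antisymm hle (Nat.le_of_dvd hpos hdvd)

/-- **"The case `v = n` gives a single orbit"**: if `|V| = 2ⁿ` the orbit of `Φ` is the set of ALL CM types.
[cite: Dodson1984, §5.1.3 Proposition 1 (proof)] -/
theorem orbit_eq_setOf_isCMTypeWith_of_card_pairKernel_eq [FaithfulSMul G E] [Finite G] [Finite E]
    (h : IsCMTypeWith ρ Φ) {V : Subgroup G} (hV : ∀ g : G, g ∈ V ↔ ∀ x : E, g • x = x ∨ g • x = ρ • x)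
    (hv : Nat.card V = 2 ^ (Nat.card E / 2)) :
    MulAction.orbit G Φ = {Ψ : Set E | IsCMTypeWith ρ Ψ} := by
  apply Set.eq_of_subset_of_ncard_le h.orbit_subset_setOf_isCMTypeWith ?_ (Set.toFinite _)
  rw [← Nat.card_coe_set_eq, ← Nat.card_coe_set_eq, h.card_orbit_eq_two_pow_of_card_pairKernel_eq hV hv]
  exact (h.natCard_setOf_isCMTypeWith).le

/-- **A single orbit**, membership form: if `|V| = 2ⁿ`, every CM type `Ψ` is a `G`-translate of `Φ` (all CM types
of `K` are Galois conjugate). [cite: Dodson1984, §5.1.3 Proposition 1 (proof)] -/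
theorem mem_orbit_of_card_pairKernel_eq [FaithfulSMul G E] [Finite G] [Finite E] (h : IsCMTypeWith ρ Φ)
    {V : Subgroup G} (hV : ∀ g : G, g ∈ V ↔ ∀ x : E, g • x = x ∨ g • x = ρ • x)
    (hv : Nat.card V = 2 ^ (Nat.card E / 2)) {Ψ : Set E} (hΨ : IsCMTypeWith ρ Ψ) :
    Ψ ∈ MulAction.orbit G Φ := by
  rw [h.orbit_eq_setOf_isCMTypeWith_of_card_pairKernel_eq hV hv]
  exact hΨ

/-- **`v = n` ⟹ `H′(Φ)` splits the imprimitivity sequence**: if `|V| = 2ⁿ` the stabiliser of every CM type is a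
complement of the pair kernel. [cite: Dodson1984, §2.1.2 Corollary] -/
theorem isComplement'_stabilizer_of_card_pairKernel_eq [FaithfulSMul G E] [Finite G] [Finite E]
    (h : IsCMTypeWith ρ Φ) {V : Subgroup G} (hV : ∀ g : G, g ∈ V ↔ ∀ x : E, g • x = x ∨ g • x = ρ • x)
    (hv : Nat.card V = 2 ^ (Nat.card E / 2)) : (MulAction.stabilizer G Φ).IsComplement' V :=
  (h.isComplement'_stabilizer_pairKernel_iff hV).2 ((h.card_orbit_eq_two_pow_of_card_pairKernel_eq hV hv).trans hv.symm)

/-- **Ribet's Corollary (3.6), group level: an orbit of `2ⁿ` CM types forces `rank(Φ) = n + 1`** ("by (3.5) and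
(3.4), `d + 1 = 2 + Log d′ ≤ rank(E,S) ≤ d + 1`"): Ribet's `log₂`-bound for the reflex type realised on the orbit
(`reflexTypeOrbit`, always separating) and `rank(Φ*) = rank(Φ)` (Shimura §32.9, `typeRank_reflexTypeOrbit`).
[cite: Ribet1980, §3 Cor. (3.6) (p. 87)] -/
theorem typeRank_eq_of_card_orbit_eq_two_pow [MulAction.IsPretransitive G E] [Fintype E] [Nonempty E]
    (h : IsCMTypeWith ρ Φ) (horb : Nat.card (MulAction.orbit G Φ) = 2 ^ (Fintype.card E / 2)) :
    typeRank G Φ = Fintype.card E / 2 + 1 := by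
  classical
  obtain ⟨φh⟩ := ‹Nonempty E›
  haveI : Fintype (MulAction.orbit G Φ) := Fintype.ofFinite _
  haveI : Nonempty (MulAction.orbit G Φ) := ⟨⟨Φ, MulAction.mem_orbit_self Φ⟩⟩
  have hstar := h.isCMTypeWith_reflexTypeOrbit (G := G) φh
  -- the reflex type separates the points of the orbit
  have hsep : ∀ Ψ₁ Ψ₂ : MulAction.orbit G Φ,
      (∀ g : G, g • Ψ₁ ∈ reflexTypeOrbit G Φ φh ↔ g • Ψ₂ ∈ reflexTypeOrbit G Φ φh) → Ψ₁ = Ψ₂ := by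
    intro Ψ₁ Ψ₂ hg
    apply Subtype.ext
    ext y
    obtain ⟨g, rfl⟩ := MulAction.exists_smul_eq G φh y
    have := hg g⁻¹
    rwa [smul_mem_reflexTypeOrbit_iff, smul_mem_reflexTypeOrbit_iff, inv_inv] at this
  have hb := hstar.two_mul_card_le_two_pow_typeRank hsep
  rw [typeRank_reflexTypeOrbit Φ φh, ← Nat.card_eq_fintype_card, horb, ← pow_succ'] at hb
  have hge := (Nat.pow_le_pow_iff_right (by norm_num : 1 < 2)).1 hb
  exact le_antisymm h.typeRank_le hge

/-- **`v = n` ⟹ every CM type is nondegenerate**: if the pair kernel has `2ⁿ` elements then `rank(Φ) = n + 1` for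
every CM type `Φ` (Dodson's single orbit of size `2ⁿ` and Ribet's Cor. (3.6)).
[cite: Ribet1980, §3 Cor. (3.6) (p. 87)] [cite: Dodson1984, §5.1.3 Proposition 1 (proof)] -/
theorem typeRank_eq_of_card_pairKernel_eq [FaithfulSMul G E] [Finite G] [MulAction.IsPretransitive G E]
    [Fintype E] [Nonempty E] (h : IsCMTypeWith ρ Φ) {V : Subgroup G}
    (hV : ∀ g : G, g ∈ V ↔ ∀ x : E, g • x = x ∨ g • x = ρ • x) (hv : Nat.card V = 2 ^ (Fintype.card E / 2)) :
    typeRank G Φ = Fintype.card E / 2 + 1 := by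
  apply h.typeRank_eq_of_card_orbit_eq_two_pow
  rw [← Nat.card_eq_fintype_card] at hv ⊢
  exact h.card_orbit_eq_two_pow_of_card_pairKernel_eq hV hv

/-- **All pair flips present ⟹ `v = n`**: if for every `x` some element of `G` exchanges `x, ρx` and fixes every
other point, the pair kernel has all `2ⁿ` elements (it acts transitively on the `2ⁿ` CM types:
`exists_pairPreserving_translate`). [cite: Dodson1984, §5.1.2 (the split structures `(ℤ₂)ⁿ ⋊ G₀`)] -/
theorem card_pairKernel_eq_two_pow_of_flips [FaithfulSMul G E] [Finite G] [Finite E] (h : IsCMTypeWith ρ Φ)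
    {V : Subgroup G} (hV : ∀ g : G, g ∈ V ↔ ∀ x : E, g • x = x ∨ g • x = ρ • x)
    (hflip : ∀ x : E, ∃ φ : G, φ • x = ρ • x ∧ ∀ y : E, y ≠ x → y ≠ ρ • x → φ • y = y) :
    Nat.card V = 2 ^ (Nat.card E / 2) := by
  classical
  haveI : Fintype E := Fintype.ofFinite E
  apply le_antisymm (h.card_pairKernel_le_two_pow hV)
  rw [← h.natCard_setOf_isCMTypeWith]
  -- `a ↦ a⁻¹Φ` maps `V` onto the CM types
  refine Nat.card_le_card_of_surjective
    (fun a : V => (⟨{x : E | (a : G) • x ∈ Φ}, h.preimage_smul a⟩ : {Ψ : Set E // IsCMTypeWith ρ Ψ})) ?_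
  rintro ⟨T, hT⟩
  obtain ⟨a, ha, haT⟩ := exists_pairPreserving_translate h hflip hT
  refine ⟨⟨a, (hV a).2 ha⟩, Subtype.ext ?_⟩
  ext x
  exact haT x

end IsCMTypeWith

end GroupLevel

/-! ## Part II — number fields: `[Kᶜ : K₀ᶜ] = 2ⁿ` -/

section NumberField

open NumberField IntermediateField
open Literature.AlgebraicGeometry
open Literature.AlgebraicGeometry.Motives (CMType)

variable {K : Type} [Field K] [NumberField K] [IsCMField K]
variable {L : Type} [Field L] [NumberField L] [IsCMField L] [IsNormalClosure ℚ K L]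

omit [IsCMField K] [IsCMField L] in
/-- `v = n` read on the pair kernel `Gal(L/K₀ᶜ)`: `[L : K₀ᶜ] = 2ⁿ` means `|Gal(L/K₀ᶜ)| = 2^{|Hom(K,L)|/2}`. [folklore] -/
private theorem natCard_fixingSubgroup_eq_of_finrank_eq
    (hv : Module.finrank (normalClosure ℚ (maximalRealSubfield K) L) L = 2 ^ (Module.finrank ℚ K / 2)) :
    Nat.card (normalClosure ℚ (maximalRealSubfield K) L).fixingSubgroup = 2 ^ (Nat.card (K →ₐ[ℚ] L) / 2) := by
  haveI : IsGalois ℚ L := isGalois_of_isNormalClosure (L := L) K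
  rw [IsGalois.card_fixingSubgroup_eq_finrank, hv, Nat.card_eq_fintype_card, card_algHom_eq_finrank K]

/-- **`v = n` ⟹ `[K′ : ℚ] = 2ⁿ` for every CM type** of the CM field `K` (`L = Kᶜ` a normal closure,
`K₀ᶜ = normalClosure ℚ K⁺ L`, `2n = [K : ℚ]`): "Shimura has shown that there exist CM-fields such that the
maximal degree `[K′ : ℚ] = 2ⁿ` occurs" — it occurs for ALL types as soon as `[Kᶜ : K₀ᶜ] = 2ⁿ`.
[cite: Dodson1984, §1.3 Reflex Degree Theorem] [cite: Dodson1984, §5.1.3 Proposition 1 (proof)] -/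
theorem finrank_reflexField_eq_two_pow_of_finrank_normalClosure_eq (j : K →ₐ[ℚ] L)
    (hv : Module.finrank (normalClosure ℚ (maximalRealSubfield K) L) L = 2 ^ (Module.finrank ℚ K / 2))
    {Ψ : Set (K →ₐ[ℚ] L)} (hΨ : IsCMTypeWith (conjGal : L ≃ₐ[ℚ] L) Ψ) :
    Module.finrank ℚ (reflexField ℚ L Ψ) = 2 ^ (Module.finrank ℚ K / 2) := by
  haveI : Normal ℚ L := IsNormalClosure.normal (F := ℚ) (K := K) (L := L)
  haveI : IsGalois ℚ L := isGalois_of_isNormalClosure (L := L) K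
  have hV := mem_fixingSubgroup_normalClosure_maximalRealSubfield_iff (K := K) (L := L) j
  have horb := hΨ.card_orbit_eq_two_pow_of_card_pairKernel_eq hV (natCard_fixingSubgroup_eq_of_finrank_eq hv)
  rw [finrank_reflexField_eq_card_orbit, horb, Nat.card_eq_fintype_card, card_algHom_eq_finrank K]

/-- **"The case `v = n` gives a single orbit"**: if `[Kᶜ : K₀ᶜ] = 2ⁿ`, any two CM types of `K` (read in
`Hom_ℚ(K, L)`) are conjugate under `Gal(L/ℚ)`. [cite: Dodson1984, §5.1.3 Proposition 1 (proof)] -/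
theorem exists_smul_eq_of_finrank_normalClosure_eq (j : K →ₐ[ℚ] L)
    (hv : Module.finrank (normalClosure ℚ (maximalRealSubfield K) L) L = 2 ^ (Module.finrank ℚ K / 2))
    {Ψ₁ Ψ₂ : Set (K →ₐ[ℚ] L)} (hΨ₁ : IsCMTypeWith (conjGal : L ≃ₐ[ℚ] L) Ψ₁)
    (hΨ₂ : IsCMTypeWith (conjGal : L ≃ₐ[ℚ] L) Ψ₂) : ∃ g : L ≃ₐ[ℚ] L, g • Ψ₁ = Ψ₂ := by
  haveI : Normal ℚ L := IsNormalClosure.normal (F := ℚ) (K := K) (L := L)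
  have hV := mem_fixingSubgroup_normalClosure_maximalRealSubfield_iff (K := K) (L := L) j
  have hmem := hΨ₁.mem_orbit_of_card_pairKernel_eq hV (natCard_fixingSubgroup_eq_of_finrank_eq hv) hΨ₂
  exact MulAction.mem_orbit_iff.1 hmem

/-- **`v = n` ⟹ the imprimitivity sequence splits through `Gal(L/K′)`** for the reflex field `K′` of every CM
type: `Gal(L/K′)` is a complement of `Gal(L/K₀ᶜ) = (ℤ₂)ⁿ`. [cite: Dodson1984, §2.1.2 Corollary] -/
theorem isComplement'_of_finrank_normalClosure_eq (j : K →ₐ[ℚ] L)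
    (hv : Module.finrank (normalClosure ℚ (maximalRealSubfield K) L) L = 2 ^ (Module.finrank ℚ K / 2))
    {Ψ : Set (K →ₐ[ℚ] L)} (hΨ : IsCMTypeWith (conjGal : L ≃ₐ[ℚ] L) Ψ) :
    (reflexField ℚ L Ψ).fixingSubgroup.IsComplement' (normalClosure ℚ (maximalRealSubfield K) L).fixingSubgroup :=
  (finrank_reflexField_eq_iff_isComplement' j hΨ).1
    ((finrank_reflexField_eq_two_pow_of_finrank_normalClosure_eq j hv hΨ).trans hv.symm)

/-- … equivalently `K′ ∩ K₀ᶜ = ℚ`. [cite: Dodson1984, §2.1.2 Corollary] -/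
theorem reflexField_inf_normalClosure_eq_bot_of_finrank_eq (j : K →ₐ[ℚ] L)
    (hv : Module.finrank (normalClosure ℚ (maximalRealSubfield K) L) L = 2 ^ (Module.finrank ℚ K / 2))
    {Ψ : Set (K →ₐ[ℚ] L)} (hΨ : IsCMTypeWith (conjGal : L ≃ₐ[ℚ] L) Ψ) :
    reflexField ℚ L Ψ ⊓ normalClosure ℚ (maximalRealSubfield K) L = ⊥ :=
  (finrank_reflexField_eq_iff_inf_eq_bot j hΨ).1
    ((finrank_reflexField_eq_two_pow_of_finrank_normalClosure_eq j hv hΨ).trans hv.symm)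

/-- **`v = n` ⟹ every CM type of `K` is nondegenerate** (Ribet's Cor. (3.6): `[K′ : ℚ] = 2ⁿ` forces
`Rank(Φ) = n + 1`; here for every complex CM type `Φ : CMType K`, `[K′(Φ) : ℚ] = 2ⁿ` by the single-orbit theorem).
[cite: Ribet1980, §3 Cor. (3.6) (p. 87)] [cite: Dodson1984, §5.1.3 Proposition 1 (proof)] -/
theorem isNondegenerate_of_finrank_normalClosure_eq (j : K →ₐ[ℚ] L)
    (hv : Module.finrank (normalClosure ℚ (maximalRealSubfield K) L) L = 2 ^ (Module.finrank ℚ K / 2))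
    (ι : L →+* ℂ) (Φ : CMType K) : Pohlmann1968.IsNondegenerate Φ := by
  haveI : Normal ℚ L := IsNormalClosure.normal (F := ℚ) (K := K) (L := L)
  haveI : IsGalois ℚ L := isGalois_of_isNormalClosure (L := L) K
  exact isNondegenerate_of_finrank_reflexField_eq j ι Φ
    (finrank_reflexField_eq_two_pow_of_finrank_normalClosure_eq j hv (isCMTypeWith_conjGal_algValuedIn ι Φ))

end NumberField

/-! ## Part III — abelian varieties: no exceptional Hodge classes on any power, for ANY CM type of such a `K` -/

section AbelianVariety

open NumberField IntermediateField CategoryTheory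
open Literature.AlgebraicGeometry
open Literature.AlgebraicGeometry.Motives (AbelianVariety CMType)
open Literature.AlgebraicGeometry.HodgeTheory
open Literature.AlgebraicGeometry.ComplexMultiplication (IsCMTypeRealisation)
open Literature.AlgebraicGeometry.VanGeemen1994 (hodgeClassSpan)
open Literature.Barriers.HodgeConjecture (divisorClassesSpan)

variable {K : Type} [Field K] [NumberField K] [IsCMField K]
variable {L : Type} [Field L] [NumberField L] [IsCMField L] [IsNormalClosure ℚ K L]
variable {Φ : CMType K} {A : AbelianVariety ℂ} {ι : 𝓞 K →+* End A} {θ : K →+* Module.End ℂ (complexBetti A.X 1)}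

/-- **`[Kᶜ : K₀ᶜ] = 2ⁿ` ⟹ `Bᵐ(Aᵏ) ⊗ ℂ = Dᵐ(Aᵏ) ⊗ ℂ` for every abelian variety `A` of ANY CM type `(K; Φ)` and all
`k, m`**: every CM type of `K` is nondegenerate (Ribet Cor. 3.6 + Dodson's single orbit), and nondegenerate types
carry no exceptional Hodge classes on any power (White–Hazama, the tree's
`IsNondegenerate.hodgeClassSpan_pow_eq_divisorClassesSpan`). [cite: Gordon1999HodgeAVSurvey, Thm. 6.4 and §9.3]
[cite: Ribet1980, §3 Cor. (3.6) (p. 87)] -/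
theorem hodgeClassSpan_pow_eq_divisorClassesSpan_of_finrank_normalClosure_eq (j : K →ₐ[ℚ] L)
    (hv : Module.finrank (normalClosure ℚ (maximalRealSubfield K) L) L = 2 ^ (Module.finrank ℚ K / 2))
    (hA : IsCMTypeRealisation Φ A ι θ) (k m : ℕ) :
    hodgeClassSpan (⨁ fun _ : Fin k => A).dim (⨁ fun _ : Fin k => A).X m =
      divisorClassesSpan (⨁ fun _ : Fin k => A).X (⨁ fun _ : Fin k => A).dim m := by
  obtain ⟨ιL⟩ : Nonempty (L →+* ℂ) := inferInstance
  exact (isNondegenerate_of_finrank_normalClosure_eq j hv ιL Φ).hodgeClassSpan_pow_eq_divisorClassesSpan hA k m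

/-- **`[Kᶜ : K₀ᶜ] = 2ⁿ` ⟹ the Hodge conjecture for every power of every abelian variety with CM by `K`**, of any CM
type, UNCONDITIONALLY (nondegenerate types: `IsNondegenerate.hodgeConjectureFor_pow`).
[cite: Gordon1999HodgeAVSurvey, Thm. 6.4 and §9.3] [cite: Ribet1980, §3 Cor. (3.6) (p. 87)] -/
theorem hodgeConjectureFor_pow_of_finrank_normalClosure_eq (j : K →ₐ[ℚ] L)
    (hv : Module.finrank (normalClosure ℚ (maximalRealSubfield K) L) L = 2 ^ (Module.finrank ℚ K / 2))
    (hA : IsCMTypeRealisation Φ A ι θ) (k : ℕ) :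
    HodgeConjectureFor (⨁ fun _ : Fin k => A).dim (⨁ fun _ : Fin k => A).X := by
  obtain ⟨ιL⟩ : Nonempty (L →+* ℂ) := inferInstance
  exact (isNondegenerate_of_finrank_normalClosure_eq j hv ιL Φ).hodgeConjectureFor_pow hA k

/-- … and for `A` itself (`HodgeConjectureFor A.dim A.X`). [cite: Gordon1999HodgeAVSurvey, §9.3] -/
theorem hodgeConjectureFor_of_finrank_normalClosure_eq (j : K →ₐ[ℚ] L)
    (hv : Module.finrank (normalClosure ℚ (maximalRealSubfield K) L) L = 2 ^ (Module.finrank ℚ K / 2))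
    (hA : IsCMTypeRealisation Φ A ι θ) : HodgeConjectureFor A.dim A.X := by
  obtain ⟨ιL⟩ : Nonempty (L →+* ℂ) := inferInstance
  exact (isNondegenerate_of_finrank_normalClosure_eq j hv ιL Φ).hodgeConjectureFor hA

end AbelianVariety

end Literature.NumberTheory.ComplexMultiplication
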